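import Literature.NumberTheory.Sieve.SieveFramework
import Mathlib.Data.Int.CardIntervalMod
import Literature.NumberTheory.Sieve.DivisorPowerSums
import HarnessLib

/-!
# `z`-rough integers in segments of coprime arithmetic progressions (fundamental lemma)

Trunk `AntSieve`.  (Sibling of `RoughNumbersInProgressions.lean`, which proves the Brun–Titchmarsh
UPPER bound for sifted progressions, Hooley's Lemma 8; the present file gives two-sided
fundamental-lemma APPROXIMATIONS with coprimality side conditions.  Its
`Literature.NumberTheory.Sieve.abs_card_Ioc_filter_modEq_sub_div_le` is the case `X₁ = 0` of
`Literature.NumberTheory.Sieve.BFI.abs_card_Ioc_filter_modEq_sub_le` below; the two files are independent.)  PROVED consequences of the Fundamental Lemma of sieve theory (named fact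
`Literature.NumberTheory.Sieve.SieveSequence.fundamental_lemma_uniform`, Friedlander–Iwaniec *Opera de Cribro* Cor. 6.10):
the `z`-rough integers (no prime factor `< z`) in a segment `(X₁, X₂]` of a reduced residue class
`r (mod k)` number
`((X₂ − X₁)/k) · W_k(z) · (1 + O(e^{−log D / log z})) + O(D)`,  `W_k(z) = ∏_{p<z, p∤k} (1 − 1/p)`,
uniformly in `k ≥ 1`, `2 ≤ z ≤ D` (`roughCount_approx`); the same with an extra condition
`(m, d) = 1` (`roughCountCop_approx`, Möbius inversion over the prime factors `≥ z` of `d`, losing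
a factor `τ(d)`), and the resulting bound for the discrepancy
`#{m : m ≡ r (k), (m,d)=1, rough} − φ(k)⁻¹ #{m : (m, dk) = 1, rough}` (`roughCountCop_disc_le`), whose
main terms cancel exactly (`main_term_identity`).  In Bombieri–Friedlander–Iwaniec's proof of
Theorem 10 (Acta Math. 156 (1986), §§12, 15) these give hypothesis (A₂) for the pieces `1_{(n,P(z))=1}`
of the sieved Heath-Brown identity ("a consequence of the Siegel–Walfisz theorem", p. 246 — for
these pieces the fundamental lemma, Lemma 4 p. 211, is what is used, cf. p. 238) and the treatment
of an almost-prime variable (p. 238, `Δ(M,N;q)`).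

## Contents

* `Literature.BFI.coprimeRecip k` — the density `g(d) = 1/d` for `(d,k)=1`, `0` otherwise; multiplicative,
  of sieve dimension `1` with the absolute constant `e⁵` (`hasSieveDimension_coprimeRecip`).
* `Literature.BFI.roughDensity k z = W_k(z)`, `Literature.BFI.roughCount X₁ X₂ k r z`,
  `Literature.BFI.roughCountCop X₁ X₂ k r d z`, `Literature.BFI.roughRadical d z = ∏_{p ∣ d, p ≥ z} p`,
  `Literature.BFI.roughCorr k d z = ∏_{p∣d, p≥z}(1 − g_k(p))`.
* `Literature.NumberTheory.Sieve.BFI.abs_card_Ioc_filter_modEq_sub_le` — `|#{X₁<m≤X₂ : m ≡ c (M)} − (X₂−X₁)/M| ≤ 1`.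
* `Literature.NumberTheory.Sieve.BFI.roughCount_approx`, `Literature.NumberTheory.Sieve.BFI.roughCountCop_approx`, `Literature.NumberTheory.Sieve.BFI.main_term_identity`,
  `Literature.NumberTheory.Sieve.BFI.roughCountCop_disc_le` (all taking the fundamental lemma as a hypothesis `hFL`).

## References

* J. Friedlander, H. Iwaniec, *Opera de Cribro*, AMS Colloquium Publ. 57 (2010), Cor. 6.10.
  [FriedlanderIwaniecOpera2010]
* E. Bombieri, J. B. Friedlander, H. Iwaniec, Acta Math. 156 (1986), §2 Lemma 4 p. 211, §12 p. 238,
  §15 p. 244–246. [BombieriFriedlanderIwaniecActa1986]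
-/

open Finset Real
open scoped ArithmeticFunction.Moebius ArithmeticFunction.sigma

namespace Literature.NumberTheory.Sieve

namespace BFI

/-! ### Counting a residue class in a segment -/

/-- `|#{m ∈ (X₁, X₂] : m ≡ c (mod M)} − (X₂ − X₁)/M| ≤ 1` for `M ≥ 1`, `X₁ ≤ X₂` (Mathlib's exact
count `⌊(X₂ − c)/M⌋ − ⌊(X₁ − c)/M⌋`). [folklore] -/
theorem abs_card_Ioc_filter_modEq_sub_le {M : ℕ} (hM : 0 < M) (c : ℕ) {X₁ X₂ : ℕ} (h : X₁ ≤ X₂) :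
    |(#((Ioc X₁ X₂).filter (fun m : ℕ => m ≡ c [MOD M])) : ℝ) - ((X₂ : ℝ) - X₁) / M| ≤ 1 := by
  have hZ := Nat.Ioc_filter_modEq_card X₁ X₂ hM c
  set n := #((Ioc X₁ X₂).filter (fun m : ℕ => m ≡ c [MOD M])) with hn
  set u : ℚ := ((X₂ : ℚ) - c) / M with hu
  set w : ℚ := ((X₁ : ℚ) - c) / M with hw
  have hM' : (0 : ℚ) < M := by exact_mod_cast hM
  have hwu : w ≤ u := by
    rw [hu, hw]
    exact div_le_div_of_nonneg_right (by simp; exact_mod_cast h) hM'.le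
  have hfl : ⌊w⌋ ≤ ⌊u⌋ := Int.floor_mono hwu
  have hmax : max (⌊u⌋ - ⌊w⌋) 0 = ⌊u⌋ - ⌊w⌋ := max_eq_left (sub_nonneg.2 hfl)
  rw [hmax] at hZ
  have h1 : (⌊u⌋ : ℚ) ≤ u := Int.floor_le u
  have h2 : u < ⌊u⌋ + 1 := Int.lt_floor_add_one u
  have h3 : (⌊w⌋ : ℚ) ≤ w := Int.floor_le w
  have h4 : w < ⌊w⌋ + 1 := Int.lt_floor_add_one w
  have huw : u - w = ((X₂ : ℚ) - X₁) / M := by rw [hu, hw]; field_simp; ring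
  have hQ : |((n : ℤ) : ℚ) - ((X₂ : ℚ) - X₁) / M| ≤ 1 := by
    rw [hZ, ← huw, abs_le]
    push_cast
    constructor <;> linarith
  have hR := (Rat.cast_le (K := ℝ)).2 hQ
  push_cast at hR
  exact hR

/-- In a reduced class: `m ≡ r (mod k)` and `d ∣ m` with `(d, k) = 1` is one class modulo `kd`
(Chinese remainder theorem). [folklore] -/
theorem filter_modEq_and_dvd_eq {k d : ℕ} (hkd : k.Coprime d) (r : ℕ) (S : Finset ℕ) :
    S.filter (fun m : ℕ => m ≡ r [MOD k] ∧ d ∣ m) =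
      S.filter (fun m : ℕ => m ≡ (Nat.chineseRemainder hkd r 0 : ℕ) [MOD k * d]) := by
  ext m
  simp only [Finset.mem_filter, and_congr_right_iff]
  intro _
  have hc := (Nat.chineseRemainder hkd r 0).prop
  rw [← Nat.modEq_and_modEq_iff_modEq_mul hkd, Nat.dvd_iff_mod_eq_zero]
  constructor
  · rintro ⟨h1, h2⟩
    exact ⟨h1.trans hc.1.symm, (show m ≡ 0 [MOD d] from h2).trans hc.2.symm⟩
  · rintro ⟨h1, h2⟩
    exact ⟨h1.trans hc.1, h2.trans hc.2⟩

/-! ### The density `g_k(d) = 1_{(d,k)=1}/d` -/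

/-- The density of the reduced class `r (mod k)` with respect to divisibility by `d`:
`g_k(d) = 1/d` if `(d, k) = 1` and `0` otherwise. [folklore] -/
noncomputable def coprimeRecip (k : ℕ) : ArithmeticFunction ℝ where
  toFun d := if d.Coprime k then ((d : ℝ))⁻¹ else 0
  map_zero' := by simp

/-- Unfolding `coprimeRecip`. [folklore] -/
theorem coprimeRecip_apply (k d : ℕ) :
    coprimeRecip k d = if d.Coprime k then ((d : ℝ))⁻¹ else 0 := rfl

/-- `g_k` is multiplicative. [folklore] -/
theorem isMultiplicative_coprimeRecip (k : ℕ) : (coprimeRecip k).IsMultiplicative := by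
  refine ⟨by simp [coprimeRecip_apply], fun {m n} hmn => ?_⟩
  simp only [coprimeRecip_apply]
  by_cases hm : m.Coprime k <;> by_cases hn : n.Coprime k
  · rw [if_pos (Nat.Coprime.mul_left hm hn), if_pos hm, if_pos hn]; push_cast; rw [mul_inv]
  · rw [if_neg (fun h => hn (Nat.Coprime.coprime_mul_left h)), if_neg hn, mul_zero]
  · rw [if_neg (fun h => hm (Nat.Coprime.coprime_mul_right h)), if_neg hm, zero_mul]
  · rw [if_neg (fun h => hm (Nat.Coprime.coprime_mul_right h)), if_neg hm, zero_mul]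

/-- `0 ≤ g_k(d) ≤ 1/d ≤ 1`. [folklore] -/
theorem coprimeRecip_nonneg (k d : ℕ) : 0 ≤ coprimeRecip k d := by
  rw [coprimeRecip_apply]; split_ifs <;> positivity

/-- `g_k(d) ≤ 1/d`. [folklore] -/
theorem coprimeRecip_le_inv (k d : ℕ) : coprimeRecip k d ≤ ((d : ℝ))⁻¹ := by
  rw [coprimeRecip_apply]; split_ifs <;> [exact le_rfl; positivity]

/-- `g_k(p) < 1` at primes. [folklore] -/
theorem coprimeRecip_lt_one (k : ℕ) {p : ℕ} (hp : p.Prime) : coprimeRecip k p < 1 :=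
  (coprimeRecip_le_inv k p).trans_lt (inv_lt_one_of_one_lt₀ (by exact_mod_cast hp.one_lt))

/-- `g_k` has sieve dimension `1` with the absolute constant `K = e⁵`:
`∏_{w ≤ p < z} (1 − g_k(p))⁻¹ ≤ ∏_{w ≤ p ≤ z} (1 − 1/p)⁻¹ ≤ e⁵ log z / log w` (the tree's
Chebyshev-level Mertens quotient bound). [folklore] -/
theorem hasSieveDimension_coprimeRecip (k : ℕ) : HasSieveDimension (coprimeRecip k) 1 (Real.exp 5) := by
  refine ⟨fun p hp => ⟨coprimeRecip_nonneg k p, coprimeRecip_lt_one k hp⟩, fun w z hw hwz => ?_⟩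
  rw [Real.rpow_one, ← mul_div_assoc]
  refine le_trans ?_ (BombieriSieve.prod_primesGe_one_sub_inv_inv_le hw hwz)
  calc ∏ p ∈ (Nat.primesBelow ⌈z⌉₊).filter (fun p : ℕ => w ≤ (p : ℝ)), (1 - coprimeRecip k p)⁻¹
      ≤ ∏ p ∈ (Nat.primesBelow ⌈z⌉₊).filter (fun p : ℕ => w ≤ (p : ℝ)), (1 - (p : ℝ)⁻¹)⁻¹ := by
        refine Finset.prod_le_prod (fun p hp => ?_) fun p hp => ?_
        · have hpp := Nat.prime_of_mem_primesBelow (Finset.mem_filter.1 hp).1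
          exact inv_nonneg.2 (sub_nonneg.2 (coprimeRecip_lt_one k hpp).le)
        · have hpp := Nat.prime_of_mem_primesBelow (Finset.mem_filter.1 hp).1
          have hp1 : (1 : ℝ) < p := by exact_mod_cast hpp.one_lt
          refine inv_anti₀ (sub_pos.2 (inv_lt_one_of_one_lt₀ hp1)) ?_
          linarith [coprimeRecip_le_inv k p]
    _ ≤ ∏ p ∈ (Nat.primesLE ⌊z⌋₊).filter (fun p : ℕ => w ≤ (p : ℝ)), (1 - (p : ℝ)⁻¹)⁻¹ := by
        refine Finset.prod_le_prod_of_subset_of_one_le (fun p hp => ?_) (fun p hp => ?_)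
          (fun p hp _ => ?_)
        · obtain ⟨hp, hwp⟩ := Finset.mem_filter.mp hp
          obtain ⟨hpz, hpp⟩ := Nat.mem_primesBelow.mp hp
          exact BombieriSieve.mem_primesGe.mpr ⟨hpp, hwp, Nat.le_floor (Nat.lt_ceil.mp hpz).le⟩
        · exact inv_nonneg.mpr (sub_nonneg.mpr (Nat.cast_inv_le_one p))
        · have hp1 : (1 : ℝ) < p := by exact_mod_cast (BombieriSieve.mem_primesGe.mp hp).1.one_lt
          exact (one_le_inv₀ (sub_pos.mpr (inv_lt_one_of_one_lt₀ hp1))).mpr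
            (sub_le_self _ (inv_nonneg.mpr (Nat.cast_nonneg p)))

/-- `W_k(z) = ∏_{p < z} (1 − g_k(p)) = ∏_{p < z, p ∤ k} (1 − 1/p)`, the density of the `z`-rough
numbers in a reduced class modulo `k`. [folklore] -/
noncomputable def roughDensity (k : ℕ) (z : ℝ) : ℝ :=
  ∏ p ∈ Nat.primesBelow ⌈z⌉₊, (1 - coprimeRecip k p)

/-- `0 ≤ W_k(z) ≤ 1`. [folklore] -/
theorem roughDensity_nonneg (k : ℕ) (z : ℝ) : 0 ≤ roughDensity k z :=
  Finset.prod_nonneg fun _ hp => sub_nonneg.2 (coprimeRecip_lt_one k (Nat.prime_of_mem_primesBelow hp)).le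

/-- `W_k(z) ≤ 1`. [folklore] -/
theorem roughDensity_le_one (k : ℕ) (z : ℝ) : roughDensity k z ≤ 1 :=
  Finset.prod_le_one (fun _ hp => sub_nonneg.2 (coprimeRecip_lt_one k (Nat.prime_of_mem_primesBelow hp)).le)
    fun p _ => sub_le_self _ (coprimeRecip_nonneg k p)

/-! ### The counting functions -/

/-- `#{m ∈ (X₁, X₂] : m ≡ r (mod k), (m, P(z)) = 1}`: the `z`-rough integers of the segment in
the class `r`. [folklore] -/
noncomputable def roughCount (X₁ X₂ k : ℕ) (r : ZMod k) (z : ℝ) : ℕ :=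
  #((Ioc X₁ X₂).filter (fun m : ℕ => (m : ZMod k) = r ∧ m.Coprime (primesProdBelow z)))

/-- `#{m ∈ (X₁, X₂] : m ≡ r (mod k), (m, d) = 1, (m, P(z)) = 1}`. [folklore] -/
noncomputable def roughCountCop (X₁ X₂ k : ℕ) (r : ZMod k) (d : ℕ) (z : ℝ) : ℕ :=
  #((Ioc X₁ X₂).filter (fun m : ℕ => (m : ZMod k) = r ∧ m.Coprime d ∧ m.Coprime (primesProdBelow z)))

/-! ### The sieve sequence of a class in a segment -/

/-- The reduced class `r (mod k)` in `(X₁, X₂]` as a sifted sequence: `a_m = 1` on the class,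
`X = (X₂ − X₁)/k`, density `g_k`. [folklore] -/
noncomputable def classSeq (X₁ X₂ k : ℕ) (r : ZMod k) : SieveSequence where
  a m := if X₁ < m ∧ m ≤ X₂ ∧ (m : ZMod k) = r then 1 else 0
  a_nonneg m := by split_ifs <;> norm_num
  size _ := ((X₂ : ℝ) - X₁) / k
  density := coprimeRecip k
  density_mult := isMultiplicative_coprimeRecip k

/-- The sifted sum of `classSeq` at height `X₂` is `roughCount`. [folklore] -/
theorem classSeq_sifted (X₁ X₂ k : ℕ) (r : ZMod k) (z : ℝ) :
    (classSeq X₁ X₂ k r).sifted X₂ (primesProdBelow z) = roughCount X₁ X₂ k r z := by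
  rw [SieveSequence.sifted, roughCount, Nat.floor_natCast]
  simp only [classSeq]
  rw [Finset.sum_ite, Finset.sum_const_zero, add_zero, Finset.sum_const, nsmul_eq_mul, mul_one]
  congr 1
  congr 1
  ext m
  simp only [Finset.mem_filter, Finset.mem_Ioc]
  constructor
  · rintro ⟨⟨⟨-, -⟩, hc⟩, h1, h2, h3⟩; exact ⟨⟨h1, h2⟩, h3, hc⟩
  · rintro ⟨⟨h1, h2⟩, h3, hc⟩; exact ⟨⟨⟨by omega, h2⟩, hc⟩, h1, h2, h3⟩

/-- `A_d(X₂) = #{m ∈ (X₁, X₂] : m ≡ r (k), d ∣ m}` for `classSeq`. [folklore] -/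
theorem classSeq_congrSum (X₁ X₂ k : ℕ) (r : ZMod k) (d : ℕ) :
    (classSeq X₁ X₂ k r).congrSum d X₂ =
      #((Ioc X₁ X₂).filter (fun m : ℕ => (m : ZMod k) = r ∧ d ∣ m)) := by
  rw [SieveSequence.congrSum, Nat.floor_natCast]
  simp only [classSeq]
  rw [Finset.sum_ite, Finset.sum_const_zero, add_zero, Finset.sum_const, nsmul_eq_mul, mul_one]
  congr 1
  congr 1
  ext m
  simp only [Finset.mem_filter, Finset.mem_Ioc]
  constructor
  · rintro ⟨⟨⟨-, -⟩, hd⟩, h1, h2, h3⟩; exact ⟨⟨h1, h2⟩, h3, hd⟩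
  · rintro ⟨⟨h1, h2⟩, h3, hd⟩; exact ⟨⟨⟨by omega, h2⟩, hd⟩, h1, h2, h3⟩

/-- **The remainders of `classSeq` are at most `1` in absolute value** (for a reduced class `r`):
if `(d,k) = 1` the conditions `m ≡ r (k)`, `d ∣ m` form one class mod `kd` (CRT) and the count
differs from `(X₂−X₁)/(kd)` by at most `1`; if `(d, k) > 1` both the count and the density vanish.
[folklore] -/
theorem abs_classSeq_remainder_le {X₁ X₂ k : ℕ} (hk : 0 < k) {r : ZMod k} (hr : IsUnit r)
    (hX : X₁ ≤ X₂) (d : ℕ) : |(classSeq X₁ X₂ k r).remainder d X₂| ≤ 1 := by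
  haveI : NeZero k := ⟨hk.ne'⟩
  rw [SieveSequence.remainder, classSeq_congrSum]
  change |(#((Ioc X₁ X₂).filter (fun m : ℕ => (m : ZMod k) = r ∧ d ∣ m)) : ℝ) -
    coprimeRecip k d * (((X₂ : ℝ) - X₁) / k)| ≤ 1
  rw [coprimeRecip_apply]
  -- the class `r` as a natural residue
  have hr' : ∀ m : ℕ, ((m : ZMod k) = r ↔ m ≡ r.val [MOD k]) := by
    intro m
    rw [← ZMod.natCast_eq_natCast_iff, ZMod.natCast_zmod_val]
  by_cases hdk : d.Coprime k
  · rw [if_pos hdk]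
    rcases Nat.eq_zero_or_pos d with rfl | hd
    · -- `d = 0` coprime to `k` forces `k = 1`; the count of `0 ∣ m` is `0`
      simp only [Nat.cast_zero, inv_zero, zero_mul, sub_zero]
      rw [Finset.filter_false_of_mem, Finset.card_empty]
      · simp
      · intro m hm ⟨_, h0⟩
        rw [zero_dvd_iff] at h0
        rw [Finset.mem_Ioc] at hm
        omega
    have hset : (Ioc X₁ X₂).filter (fun m : ℕ => (m : ZMod k) = r ∧ d ∣ m) =
        (Ioc X₁ X₂).filter (fun m : ℕ => m ≡ (Nat.chineseRemainder hdk.symm r.val 0 : ℕ) [MOD k * d]) := by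
      rw [← filter_modEq_and_dvd_eq hdk.symm r.val]
      refine Finset.filter_congr fun m _ => ?_
      rw [hr']
    rw [hset]
    have h := abs_card_Ioc_filter_modEq_sub_le (Nat.mul_pos hk hd)
      (Nat.chineseRemainder hdk.symm r.val 0 : ℕ) hX
    have : ((d : ℝ))⁻¹ * (((X₂ : ℝ) - X₁) / k) = ((X₂ : ℝ) - X₁) / ((k * d : ℕ) : ℝ) := by
      push_cast
      field_simp
    rw [this]
    exact h
  · rw [if_neg hdk, zero_mul, sub_zero]
    -- a common prime factor of `d` and `k` would divide `r`, contradicting `(r, k) = 1`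
    rw [Finset.filter_false_of_mem, Finset.card_empty]
    · simp
    · rintro m - ⟨hmr, hdm⟩
      apply hdk
      rw [Nat.coprime_iff_gcd_eq_one]
      by_contra hg
      obtain ⟨p, hp, hpg⟩ := Nat.exists_prime_and_dvd hg
      have hpd : p ∣ d := hpg.trans (Nat.gcd_dvd_left d k)
      have hpk : p ∣ k := hpg.trans (Nat.gcd_dvd_right d k)
      have hpm : p ∣ m := hpd.trans hdm
      -- `m ≡ r.val (mod p)` and `p ∣ m` give `p ∣ r.val`
      have hmod : m ≡ r.val [MOD k] := (hr' m).1 hmr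
      have hmodp : m ≡ r.val [MOD p] := hmod.of_dvd hpk
      have hprv : p ∣ r.val := by
        have := (Nat.modEq_iff_dvd' (Nat.zero_le _)).1 ((Nat.modEq_zero_iff_dvd.2 hpm).symm.trans hmodp)
        simpa using this
      have hcop : r.val.Coprime k := ZMod.val_coe_unit_coprime hr.unit
      exact (Nat.Prime.one_lt hp).ne' (Nat.Coprime.eq_one_of_dvd (Nat.Coprime.coprime_dvd_left hprv hcop) hpk)

/-! ### The fundamental lemma for a class in a segment -/

/-- The divisors `d ≤ D` of `P(z)` are at most `D` in number. [folklore] -/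
theorem card_divisors_filter_le (P : ℕ) {D : ℝ} (hD : 0 ≤ D) :
    (#(P.divisors.filter (fun d : ℕ => (d : ℝ) ≤ D)) : ℝ) ≤ D := by
  calc (#(P.divisors.filter (fun d : ℕ => (d : ℝ) ≤ D)) : ℝ) ≤ #(Icc 1 ⌊D⌋₊) := by
        exact_mod_cast Finset.card_le_card fun d hd => by
          rw [Finset.mem_filter, Nat.mem_divisors] at hd
          rw [Finset.mem_Icc]
          exact ⟨Nat.pos_of_dvd_of_pos hd.1.1 (Nat.pos_of_ne_zero hd.1.2), Nat.le_floor hd.2⟩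
    _ = ⌊D⌋₊ := by simp
    _ ≤ D := Nat.floor_le hD

/-- **`z`-rough integers in a segment of a reduced class** (Fundamental Lemma, as the named fact
`Literature.NumberTheory.Sieve.SieveSequence.fundamental_lemma_uniform`, applied to `classSeq`): there is an absolute `C₀ > 0`
such that for all `k ≥ 1`, reduced `r (mod k)`, `X₁ ≤ X₂`, `2 ≤ z ≤ D`,
`|#{X₁ < m ≤ X₂ : m ≡ r (k), (m,P(z))=1} − ((X₂−X₁)/k) W_k(z)|
   ≤ C₀ ((X₂−X₁)/k) W_k(z) e^{−log D/log z} + D`.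
[cite: FriedlanderIwaniecOpera2010, Cor. 6.10] -/
theorem roughCount_approx (hFL : SieveSequence.fundamental_lemma_uniform) :
    ∃ C₀ : ℝ, 0 < C₀ ∧ ∀ k : ℕ, 0 < k → ∀ r : ZMod k, IsUnit r → ∀ X₁ X₂ : ℕ, X₁ ≤ X₂ →
      ∀ z D : ℝ, 2 ≤ z → z ≤ D →
        |(roughCount X₁ X₂ k r z : ℝ) - ((X₂ : ℝ) - X₁) / k * roughDensity k z| ≤
          C₀ * (((X₂ : ℝ) - X₁) / k) * roughDensity k z * Real.exp (-(Real.log D / Real.log z)) + D := by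
  obtain ⟨C, hC, h⟩ := hFL 1 (Real.exp 5)
  refine ⟨C, hC, fun k hk r hr X₁ X₂ hX z D hz hzD => ?_⟩
  set A := classSeq X₁ X₂ k r with hA
  have hsize : A.size (X₂ : ℝ) = ((X₂ : ℝ) - X₁) / k := rfl
  have hsize0 : 0 ≤ A.size (X₂ : ℝ) := by
    rw [hsize]; exact div_nonneg (sub_nonneg.2 (by exact_mod_cast hX)) (Nat.cast_nonneg k)
  have hV : A.densityProduct (primesProdBelow z) = roughDensity k z := by
    rw [SieveSequence.densityProduct, primeFactors_primesProdBelow, roughDensity]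
    rfl
  have h1 := h A (hasSieveDimension_coprimeRecip k) (X₂ : ℝ) z D hz hzD hsize0
  rw [classSeq_sifted, hsize, hV] at h1
  refine h1.trans (add_le_add (le_of_eq (by ring)) ?_)
  calc ∑ d ∈ (primesProdBelow z).divisors.filter (fun d : ℕ => (d : ℝ) ≤ D), |A.remainder d X₂|
      ≤ ∑ d ∈ (primesProdBelow z).divisors.filter (fun d : ℕ => (d : ℝ) ≤ D), (1 : ℝ) :=
        Finset.sum_le_sum fun d _ => abs_classSeq_remainder_le hk hr hX d
    _ = #((primesProdBelow z).divisors.filter (fun d : ℕ => (d : ℝ) ≤ D)) := by simp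
    _ ≤ D := card_divisors_filter_le _ (by linarith)

/-! ### The coprimality condition `(m, d) = 1`: Möbius inversion over the primes `≥ z` of `d` -/

/-- `d_z = ∏_{p ∣ d, p ≥ z} p`, the product of the DISTINCT prime factors `≥ z` of `d` — the radical
of the `z`-rough part of `d` (the tree's `Literature.BombieriSieve.SigmaZero.roughPart w n` is the rough
part `∏ p^{v_p(n)}` itself; only the radical matters for coprimality). [folklore] -/
noncomputable def roughRadical (d : ℕ) (z : ℝ) : ℕ :=
  ∏ p ∈ d.primeFactors.filter (fun p : ℕ => z ≤ (p : ℝ)), p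

/-- The prime factors of `d_z` are the prime factors `≥ z` of `d`. [folklore] -/
theorem primeFactors_roughRadical (d : ℕ) (z : ℝ) :
    (roughRadical d z).primeFactors = d.primeFactors.filter (fun p : ℕ => z ≤ (p : ℝ)) :=
  Nat.primeFactors_prod fun _ hp => Nat.prime_of_mem_primeFactors (Finset.mem_filter.1 hp).1

/-- `d_z` is squarefree. [folklore] -/
theorem squarefree_roughRadical (d : ℕ) (z : ℝ) : Squarefree (roughRadical d z) := by
  refine Finset.squarefree_prod_of_pairwise_isCoprime (fun p hp q hq hpq => ?_) fun p hp =>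
    (Nat.prime_of_mem_primeFactors (Finset.mem_filter.1 hp).1).squarefree
  have hp' := Nat.prime_of_mem_primeFactors (Finset.mem_filter.1 hp).1
  have hq' := Nat.prime_of_mem_primeFactors (Finset.mem_filter.1 hq).1
  exact Nat.coprime_iff_isRelPrime.1 ((Nat.coprime_primes hp' hq').2 hpq)

/-- `d_z ≠ 0`. [folklore] -/
theorem roughRadical_ne_zero (d : ℕ) (z : ℝ) : roughRadical d z ≠ 0 := (squarefree_roughRadical d z).ne_zero

/-- `d_z ∣ d`. [folklore] -/
theorem roughRadical_dvd (d : ℕ) (z : ℝ) : roughRadical d z ∣ d :=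
  (Finset.prod_dvd_prod_of_subset _ _ _ (Finset.filter_subset _ _)).trans (Nat.prod_primeFactors_dvd d)

/-- `#(d_z.divisors) ≤ τ(d)` for `d ≠ 0`. [folklore] -/
theorem card_divisors_roughRadical_le {d : ℕ} (hd : d ≠ 0) (z : ℝ) :
    #(roughRadical d z).divisors ≤ σ 0 d := by
  have h := sigma_zero_le_of_dvd hd (roughRadical_dvd d z)
  rwa [ArithmeticFunction.sigma_zero_apply (n := roughRadical d z)] at h

/-- Every divisor of `d_z` is coprime to `P(z)` (its prime factors are `≥ z`). [folklore] -/
theorem coprime_primesProdBelow_of_dvd_roughRadical {d t : ℕ} {z : ℝ} (ht : t ∣ roughRadical d z) :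
    t.Coprime (primesProdBelow z) := by
  rw [coprime_primesProdBelow_iff]
  intro q hq hqt
  obtain ⟨hqz, hqp⟩ := Nat.mem_primesBelow.1 hq
  have hmem : q ∈ (roughRadical d z).primeFactors :=
    Nat.mem_primeFactors.2 ⟨hqp, hqt.trans ht, roughRadical_ne_zero d z⟩
  rw [primeFactors_roughRadical, Finset.mem_filter] at hmem
  exact (Nat.lt_ceil.1 hqz).not_ge hmem.2

/-- For `m` coprime to `P(z)`: `(m, d) = 1 ↔ (m, d_z) = 1` (`d ≠ 0`). [folklore] -/
theorem coprime_iff_coprime_roughRadical {m d : ℕ} (hd : d ≠ 0) {z : ℝ}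
    (hm : m.Coprime (primesProdBelow z)) : m.Coprime d ↔ m.Coprime (roughRadical d z) := by
  constructor
  · exact fun h => Nat.Coprime.coprime_dvd_right (roughRadical_dvd d z) h
  · intro h
    rw [Nat.coprime_iff_gcd_eq_one]
    by_contra hg
    obtain ⟨p, hp, hpg⟩ := Nat.exists_prime_and_dvd hg
    have hpm : p ∣ m := hpg.trans (Nat.gcd_dvd_left m d)
    have hpd : p ∣ d := hpg.trans (Nat.gcd_dvd_right m d)
    -- `p ≥ z` since `m` is coprime to `P(z)`
    have hpz : z ≤ (p : ℝ) := by
      by_contra hlt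
      rw [not_le] at hlt
      have h1 : p ∣ primesProdBelow z := (dvd_primesProdBelow_iff hp z).2 hlt
      exact (Nat.Prime.one_lt hp).ne' (Nat.Coprime.eq_one_of_dvd (Nat.Coprime.coprime_dvd_left hpm hm) h1)
    have hpdz : p ∣ roughRadical d z := by
      apply Finset.dvd_prod_of_mem
      exact Finset.mem_filter.2 ⟨Nat.mem_primeFactors.2 ⟨hp, hpd, hd⟩, hpz⟩
    exact (Nat.Prime.one_lt hp).ne' (Nat.Coprime.eq_one_of_dvd (Nat.Coprime.coprime_dvd_left hpm h) hpdz)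

/-- Möbius inversion of a coprimality condition: for `m ≠ 0` and `e ≠ 0`,
`1_{(m,e)=1} = ∑_{t ∣ e, t ∣ m} μ(t)`.  This is the statement of the tree's
`Literature.NumberTheory.Sieve.ite_coprime_eq_sum_moebius` (`AsymptoticSieveForPrimesLogSums`) and of
`MaynardSieve.ite_coprime_eq_sum_moebius`; restated here to keep the import closure small (a
librarian pass may consolidate). [folklore] -/
theorem coprime_indicator_eq_sum_moebius {m e : ℕ} (hm : m ≠ 0) (he : e ≠ 0) :
    (if m.Coprime e then (1 : ℝ) else 0) = ∑ t ∈ e.divisors.filter (fun t : ℕ => t ∣ m), (μ t : ℝ) := by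
  have hset : e.divisors.filter (fun t : ℕ => t ∣ m) = (Nat.gcd m e).divisors := by
    ext t
    simp only [Finset.mem_filter, Nat.mem_divisors, Nat.dvd_gcd_iff, ne_eq, Nat.gcd_eq_zero_iff, not_and]
    constructor
    · rintro ⟨⟨hte, -⟩, htm⟩; exact ⟨⟨htm, hte⟩, fun h => absurd h hm⟩
    · rintro ⟨⟨htm, hte⟩, -⟩; exact ⟨⟨hte, he⟩, htm⟩
  rw [hset]
  have h := congrArg (fun f : ArithmeticFunction ℝ => f (Nat.gcd m e))
    (ArithmeticFunction.coe_zeta_mul_coe_moebius (R := ℝ))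
  simp only [ArithmeticFunction.coe_zeta_mul_apply, ArithmeticFunction.intCoe_apply,
    ArithmeticFunction.one_apply] at h
  rw [h]

/-- Dividing out a rough squarefree factor: for `t ≥ 1`,
`#{X₁ < m ≤ X₂ : t ∣ m, P(m)} = #{X₁/t < m' ≤ X₂/t : P(t m')}`. [folklore] -/
theorem card_filter_dvd_eq {t : ℕ} (ht : 0 < t) (X₁ X₂ : ℕ) (P : ℕ → Prop) [DecidablePred P] :
    #((Ioc X₁ X₂).filter (fun m : ℕ => t ∣ m ∧ P m)) =
      #((Ioc (X₁ / t) (X₂ / t)).filter (fun m' : ℕ => P (t * m'))) := by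
  refine Finset.card_bij' (fun m _ => m / t) (fun m' _ => t * m') ?_ ?_ ?_ ?_
  · intro m hm
    rw [Finset.mem_filter, Finset.mem_Ioc] at hm
    obtain ⟨⟨h1, h2⟩, ⟨q, rfl⟩, hP⟩ := hm
    rw [Finset.mem_filter, Finset.mem_Ioc, Nat.mul_div_cancel_left q ht]
    refine ⟨⟨?_, ?_⟩, hP⟩
    · rw [Nat.div_lt_iff_lt_mul ht]; rw [mul_comm] at h1; exact h1
    · rw [Nat.le_div_iff_mul_le ht]; rw [mul_comm] at h2; exact h2
  · intro m' hm'
    rw [Finset.mem_filter, Finset.mem_Ioc] at hm'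
    obtain ⟨⟨h1, h2⟩, hP⟩ := hm'
    rw [Finset.mem_filter, Finset.mem_Ioc]
    refine ⟨⟨?_, ?_⟩, ⟨m', rfl⟩, hP⟩
    · rw [Nat.div_lt_iff_lt_mul ht] at h1; rw [mul_comm]; exact h1
    · rw [Nat.le_div_iff_mul_le ht] at h2; rw [mul_comm]; exact h2
  · intro m hm
    rw [Finset.mem_filter] at hm
    obtain ⟨-, ⟨q, rfl⟩, -⟩ := hm
    rw [Nat.mul_div_cancel_left q ht]
  · intro m' _
    exact Nat.mul_div_cancel_left m' ht

/-- `|(X₂/t − X₁/t) − (X₂ − X₁)/t| ≤ 1` for natural division, `t ≥ 1`. [folklore] -/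
theorem abs_natDiv_sub_natDiv_sub_le {t : ℕ} (ht : 0 < t) (X₁ X₂ : ℕ) :
    |(((X₂ / t : ℕ) : ℝ) - ((X₁ / t : ℕ) : ℝ)) - ((X₂ : ℝ) - X₁) / t| ≤ 1 := by
  have ht' : (0 : ℝ) < t := by exact_mod_cast ht
  have key : ∀ X : ℕ, ((X / t : ℕ) : ℝ) ≤ (X : ℝ) / t ∧ (X : ℝ) / t < ((X / t : ℕ) : ℝ) + 1 := by
    intro X
    have h1 : ((X / t : ℕ) : ℝ) * t ≤ X := by exact_mod_cast Nat.div_mul_le_self X t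
    have h2 : (X : ℝ) < ((X / t : ℕ) : ℝ) * t + t := by exact_mod_cast Nat.lt_div_mul_add ht
    constructor
    · rwa [le_div_iff₀ ht']
    · rw [div_lt_iff₀ ht']; linarith
  obtain ⟨a1, a2⟩ := key X₁
  obtain ⟨b1, b2⟩ := key X₂
  rw [sub_div, abs_le]
  constructor <;> linarith

/-- `ρ_k(d, z) = ∏_{p ∣ d, p ≥ z} (1 − g_k(p)) = ∏_{p ∣ d, p ≥ z, p ∤ k} (1 − 1/p)`, the correction to
the density of rough numbers caused by the condition `(m, d) = 1`. [folklore] -/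
noncomputable def roughCorr (k d : ℕ) (z : ℝ) : ℝ :=
  ∏ p ∈ (roughRadical d z).primeFactors, (1 - coprimeRecip k p)

/-- `0 ≤ ρ ≤ 1`. [folklore] -/
theorem roughCorr_nonneg (k d : ℕ) (z : ℝ) : 0 ≤ roughCorr k d z :=
  Finset.prod_nonneg fun _ hp => sub_nonneg.2 (coprimeRecip_lt_one k (Nat.prime_of_mem_primeFactors hp)).le

/-- `ρ ≤ 1`. [folklore] -/
theorem roughCorr_le_one (k d : ℕ) (z : ℝ) : roughCorr k d z ≤ 1 :=
  Finset.prod_le_one (fun _ hp => sub_nonneg.2 (coprimeRecip_lt_one k (Nat.prime_of_mem_primeFactors hp)).le)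
    fun p _ => sub_le_self _ (coprimeRecip_nonneg k p)

/-- `ρ_k(d,z) = ∑_{t ∣ d_z} μ(t) g_k(t)` (`d_z` squarefree, `g_k` multiplicative). [folklore] -/
theorem roughCorr_eq_sum (k d : ℕ) (z : ℝ) :
    roughCorr k d z = ∑ t ∈ (roughRadical d z).divisors, (μ t : ℝ) * coprimeRecip k t :=
  ArithmeticFunction.IsMultiplicative.prodPrimeFactors_one_sub_of_squarefree _
    (isMultiplicative_coprimeRecip k) (squarefree_roughRadical d z)

/-- **Rough integers of a reduced class in a segment, with a coprimality condition** (Möbius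
inversion over `d_z` and `roughCount_approx` for each `t ∣ d_z`): there is an absolute `C₀ > 0`
(the constant of `roughCount_approx`, whose conclusion is repeated as the first conjunct) such that for `k ≥ 1`, reduced `r`, `d ≥ 1`, `X₁ ≤ X₂`, `2 ≤ z ≤ D`,
`|#{X₁<m≤X₂ : m ≡ r (k), (m,d)=1, (m,P(z))=1} − ((X₂−X₁)/k) W_k(z) ρ_k(d,z)|
   ≤ τ(d) (C₀ ((X₂−X₁)/k) W_k(z) e^{−log D/log z} + C₀ + D + 1)`.
[cite: FriedlanderIwaniecOpera2010, Cor. 6.10] -/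
theorem roughCountCop_approx (hFL : SieveSequence.fundamental_lemma_uniform) :
    ∃ C₀ : ℝ, 0 < C₀ ∧ (∀ k : ℕ, 0 < k → ∀ r : ZMod k, IsUnit r → ∀ X₁ X₂ : ℕ, X₁ ≤ X₂ →
      ∀ z D : ℝ, 2 ≤ z → z ≤ D →
        |(roughCount X₁ X₂ k r z : ℝ) - ((X₂ : ℝ) - X₁) / k * roughDensity k z| ≤
          C₀ * (((X₂ : ℝ) - X₁) / k) * roughDensity k z * Real.exp (-(Real.log D / Real.log z)) + D) ∧
      ∀ k : ℕ, 0 < k → ∀ r : ZMod k, IsUnit r → ∀ d : ℕ, d ≠ 0 → ∀ X₁ X₂ : ℕ, X₁ ≤ X₂ →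
      ∀ z D : ℝ, 2 ≤ z → z ≤ D →
        |(roughCountCop X₁ X₂ k r d z : ℝ) - ((X₂ : ℝ) - X₁) / k * roughDensity k z * roughCorr k d z| ≤
          (σ 0 d : ℝ) * (C₀ * (((X₂ : ℝ) - X₁) / k) * roughDensity k z *
            Real.exp (-(Real.log D / Real.log z)) + C₀ + D + 1) := by
  obtain ⟨C₀, hC₀, h⟩ := roughCount_approx hFL
  refine ⟨C₀, hC₀, h, fun k hk r hr d hd X₁ X₂ hX z D hz hzD => ?_⟩
  haveI : NeZero k := ⟨hk.ne'⟩
  set e := roughRadical d z with he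
  have he0 : e ≠ 0 := roughRadical_ne_zero d z
  set X : ℝ := ((X₂ : ℝ) - X₁) / k with hXdef
  have hX0 : 0 ≤ X := div_nonneg (sub_nonneg.2 (by exact_mod_cast hX)) (Nat.cast_nonneg k)
  set W := roughDensity k z with hW
  have hW0 : 0 ≤ W := roughDensity_nonneg k z
  have hW1 : W ≤ 1 := roughDensity_le_one k z
  set ε := Real.exp (-(Real.log D / Real.log z)) with hε
  have hε0 : 0 ≤ ε := (Real.exp_pos _).le
  have hε1 : ε ≤ 1 := by
    rw [hε, Real.exp_le_one_iff, neg_nonpos]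
    exact div_nonneg (Real.log_nonneg (by linarith)) (Real.log_nonneg (by linarith))
  have hD0 : 0 ≤ D := by linarith
  have hk1 : (1 : ℝ) ≤ k := by exact_mod_cast hk
  -- Step 1: Möbius expansion of the count
  set N : ℕ → ℝ := fun t =>
    #((Ioc (X₁ / t) (X₂ / t)).filter (fun m' : ℕ => ((t * m' : ℕ) : ZMod k) = r ∧
      m'.Coprime (primesProdBelow z))) with hN
  have hexp : (roughCountCop X₁ X₂ k r d z : ℝ) = ∑ t ∈ e.divisors, (μ t : ℝ) * N t := by
    rw [roughCountCop]
    -- insert the indicator of `(m, e) = 1`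
    have h1 : (#((Ioc X₁ X₂).filter (fun m : ℕ => (m : ZMod k) = r ∧ m.Coprime d ∧
        m.Coprime (primesProdBelow z))) : ℝ) =
        ∑ m ∈ (Ioc X₁ X₂).filter (fun m : ℕ => (m : ZMod k) = r ∧ m.Coprime (primesProdBelow z)),
          (if m.Coprime e then (1 : ℝ) else 0) := by
      rw [Finset.sum_ite, Finset.sum_const_zero, add_zero, Finset.sum_const, nsmul_eq_mul, mul_one,
        Finset.filter_filter]
      congr 2
      refine Finset.filter_congr fun m hm => ?_
      constructor
      · rintro ⟨h1, h2, h3⟩; exact ⟨⟨h1, h3⟩, (coprime_iff_coprime_roughRadical hd h3).1 h2⟩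
      · rintro ⟨⟨h1, h3⟩, h2⟩; exact ⟨h1, (coprime_iff_coprime_roughRadical hd h3).2 h2, h3⟩
    rw [h1]
    have h2 : ∀ m ∈ (Ioc X₁ X₂).filter (fun m : ℕ => (m : ZMod k) = r ∧ m.Coprime (primesProdBelow z)),
        (if m.Coprime e then (1 : ℝ) else 0) = ∑ t ∈ e.divisors, if t ∣ m then (μ t : ℝ) else 0 := by
      intro m hm
      have hm0 : m ≠ 0 := by
        have := (Finset.mem_Ioc.1 (Finset.mem_filter.1 hm).1).1; omega
      rw [coprime_indicator_eq_sum_moebius hm0 he0, Finset.sum_filter]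
    rw [Finset.sum_congr rfl h2, Finset.sum_comm]
    refine Finset.sum_congr rfl fun t ht => ?_
    have ht0 : 0 < t := Nat.pos_of_mem_divisors ht
    have htP : t.Coprime (primesProdBelow z) :=
      coprime_primesProdBelow_of_dvd_roughRadical (Nat.dvd_of_mem_divisors ht)
    rw [← Finset.sum_filter, Finset.sum_const, nsmul_eq_mul, mul_comm, Finset.filter_filter]
    congr 1
    simp only [hN]
    have hiff : ∀ m' : ℕ, (t * m').Coprime (primesProdBelow z) ↔ m'.Coprime (primesProdBelow z) :=
      fun m' => ⟨fun h1 => Nat.Coprime.coprime_mul_left h1, fun h1 => Nat.Coprime.mul_left htP h1⟩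
    have hset1 : (Ioc X₁ X₂).filter (fun a : ℕ => ((a : ZMod k) = r ∧ a.Coprime (primesProdBelow z)) ∧ t ∣ a) =
        (Ioc X₁ X₂).filter (fun m : ℕ => t ∣ m ∧ ((m : ZMod k) = r ∧ m.Coprime (primesProdBelow z))) :=
      Finset.filter_congr fun m _ => by tauto
    have hset2 : (Ioc (X₁ / t) (X₂ / t)).filter (fun m' : ℕ => ((t * m' : ℕ) : ZMod k) = r ∧
        m'.Coprime (primesProdBelow z)) =
        (Ioc (X₁ / t) (X₂ / t)).filter (fun m' : ℕ => ((t * m' : ℕ) : ZMod k) = r ∧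
          (t * m').Coprime (primesProdBelow z)) :=
      Finset.filter_congr fun m' _ => by rw [hiff]
    rw [hset1, card_filter_dvd_eq ht0, hset2]
  -- Step 2: per-`t` estimate
  have hper : ∀ t ∈ e.divisors,
      |(μ t : ℝ) * N t - X * W * ((μ t : ℝ) * coprimeRecip k t)| ≤ C₀ * X * W * ε + C₀ + D + 1 := by
    intro t ht
    have ht0 : 0 < t := Nat.pos_of_mem_divisors ht
    have ht0' : (0 : ℝ) < t := by exact_mod_cast ht0
    have htP : t.Coprime (primesProdBelow z) :=
      coprime_primesProdBelow_of_dvd_roughRadical (Nat.dvd_of_mem_divisors ht)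
    have hμ : |(μ t : ℝ)| ≤ 1 := by exact_mod_cast ArithmeticFunction.abs_moebius_le_one
    have hRHS0 : 0 ≤ C₀ * X * W * ε + C₀ + D + 1 := by positivity
    by_cases hu : IsUnit (t : ZMod k)
    · obtain ⟨u, hu⟩ := hu
      have htk : t.Coprime k := by
        have := (ZMod.isUnit_iff_coprime t k).1 ⟨u, hu⟩; exact this
      -- `N t = roughCount (X₁/t) (X₂/t) k (u⁻¹ r) z`
      have hNt : N t = roughCount (X₁ / t) (X₂ / t) k (↑u⁻¹ * r) z := by
        simp only [hN, roughCount]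
        congr 2
        refine Finset.filter_congr fun m' _ => ?_
        have : (((t * m' : ℕ) : ZMod k) = r) ↔ ((m' : ZMod k) = ↑u⁻¹ * r) := by
          push_cast
          rw [← hu]
          constructor
          · intro h1; rw [← h1, ← mul_assoc, Units.inv_mul, one_mul]
          · intro h1; rw [h1, ← mul_assoc, Units.mul_inv, one_mul]
        rw [this]
      have hur : IsUnit (↑u⁻¹ * r) := (Units.isUnit _).mul hr
      have happ := h k hk _ hur (X₁ / t) (X₂ / t) (Nat.div_le_div_right hX) z D hz hzD
      rw [← hNt] at happ
      rw [coprimeRecip_apply, if_pos htk]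
      -- compare the two main terms
      have hdiv := abs_natDiv_sub_natDiv_sub_le ht0 X₁ X₂
      set Y : ℝ := (((X₂ / t : ℕ) : ℝ) - ((X₁ / t : ℕ) : ℝ)) / k with hY
      have hYX : |Y - X / t| ≤ 1 := by
        have : Y - X / t = ((((X₂ / t : ℕ) : ℝ) - ((X₁ / t : ℕ) : ℝ)) - ((X₂ : ℝ) - X₁) / t) / k := by
          rw [hY, hXdef]; field_simp
        rw [this, abs_div, abs_of_pos (by positivity : (0:ℝ) < k)]
        exact (div_le_one (by positivity)).2 (hdiv.trans hk1)
      have hYle : Y ≤ X + 1 := by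
        have h1 : Y ≤ X / t + 1 := by linarith [(abs_le.1 hYX).2]
        have h2 : X / t ≤ X := div_le_self hX0 (by exact_mod_cast ht0)
        linarith
      have hY0 : 0 ≤ Y := div_nonneg (sub_nonneg.2 (by exact_mod_cast Nat.div_le_div_right hX)) (Nat.cast_nonneg k)
      -- `|μ N - X W μ /t| ≤ |N - Y W| + W |Y - X/t|`
      have hmain : |N t - X * W * (t : ℝ)⁻¹| ≤ C₀ * X * W * ε + C₀ + D + 1 := by
        calc |N t - X * W * (t : ℝ)⁻¹| = |(N t - Y * W) + W * (Y - X / t)| := by ring_nf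
          _ ≤ |N t - Y * W| + |W * (Y - X / t)| := abs_add_le _ _
          _ ≤ (C₀ * Y * W * ε + D) + W * 1 := by
              refine add_le_add happ ?_
              rw [abs_mul, abs_of_nonneg hW0]
              exact mul_le_mul_of_nonneg_left hYX hW0
          _ ≤ (C₀ * (X + 1) * W * ε + D) + 1 := by
              have h1 : C₀ * Y * W * ε ≤ C₀ * (X + 1) * W * ε := by gcongr
              linarith
          _ = C₀ * X * W * ε + C₀ * (W * ε) + D + 1 := by ring
          _ ≤ C₀ * X * W * ε + C₀ * 1 + D + 1 := by
              gcongr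
              exact mul_le_one₀ hW1 hε0 hε1
          _ = C₀ * X * W * ε + C₀ + D + 1 := by ring
      calc |(μ t : ℝ) * N t - X * W * ((μ t : ℝ) * (t : ℝ)⁻¹)|
          = |(μ t : ℝ)| * |N t - X * W * (t : ℝ)⁻¹| := by rw [← abs_mul]; ring_nf
        _ ≤ 1 * (C₀ * X * W * ε + C₀ + D + 1) := mul_le_mul hμ hmain (abs_nonneg _) zero_le_one
        _ = C₀ * X * W * ε + C₀ + D + 1 := one_mul _
    · -- `t` not a unit mod `k`: both terms vanish
      have htk : ¬ t.Coprime k := fun h1 => hu ((ZMod.isUnit_iff_coprime t k).2 h1)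
      have hNt : N t = 0 := by
        simp only [hN]
        rw [Nat.cast_eq_zero, Finset.card_eq_zero, Finset.filter_eq_empty_iff]
        rintro m' - ⟨h1, -⟩
        apply hu
        push_cast at h1
        rw [← h1] at hr
        exact isUnit_of_mul_isUnit_left hr
      rw [hNt, coprimeRecip_apply, if_neg htk]
      simp only [mul_zero, sub_zero, abs_zero]
      exact hRHS0
  -- Step 3: sum over `t ∣ d_z`
  rw [hexp, roughCorr_eq_sum, Finset.mul_sum, ← Finset.sum_sub_distrib]
  calc |∑ t ∈ e.divisors, ((μ t : ℝ) * N t - X * W * ((μ t : ℝ) * coprimeRecip k t))|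
      ≤ ∑ t ∈ e.divisors, |(μ t : ℝ) * N t - X * W * ((μ t : ℝ) * coprimeRecip k t)| :=
        Finset.abs_sum_le_sum_abs _ _
    _ ≤ ∑ t ∈ e.divisors, (C₀ * X * W * ε + C₀ + D + 1) := Finset.sum_le_sum hper
    _ = #(e.divisors) * (C₀ * X * W * ε + C₀ + D + 1) := by rw [Finset.sum_const, nsmul_eq_mul]
    _ ≤ (σ 0 d : ℝ) * (C₀ * X * W * ε + C₀ + D + 1) := by
        refine mul_le_mul_of_nonneg_right ?_ (by positivity)
        exact_mod_cast card_divisors_roughRadical_le hd z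

/-! ### The main terms of the two counts agree -/

/-- `1 − g_k(p) = 1 − 1/p` for a prime `p ∤ k`, and `= 1` for `p ∣ k`. [folklore] -/
theorem one_sub_coprimeRecip_prime (k : ℕ) {p : ℕ} (hp : p.Prime) :
    1 - coprimeRecip k p = if p ∣ k then 1 else 1 - (p : ℝ)⁻¹ := by
  rw [coprimeRecip_apply]
  by_cases h : p ∣ k
  · rw [if_pos h, if_neg, sub_zero]
    exact fun hc => hp.one_lt.ne' (Nat.Coprime.eq_one_of_dvd hc h)
  · rw [if_neg h, if_pos ((Nat.Prime.coprime_iff_not_dvd hp).2 h)]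

/-- `W_k(z) = ∏_{p < z, p ∤ k} (1 − 1/p)`. [folklore] -/
theorem roughDensity_eq_prod_filter (k : ℕ) (z : ℝ) :
    roughDensity k z = ∏ p ∈ (Nat.primesBelow ⌈z⌉₊).filter (fun p : ℕ => ¬ p ∣ k), (1 - (p : ℝ)⁻¹) := by
  rw [roughDensity]
  conv_rhs => rw [Finset.prod_filter]
  refine Finset.prod_congr rfl fun p hp => ?_
  rw [one_sub_coprimeRecip_prime k (Nat.prime_of_mem_primesBelow hp)]
  by_cases h : p ∣ k <;> simp [h]

/-- `ρ_k(d, z) = ∏_{p ∣ d, p ≥ z, p ∤ k} (1 − 1/p)`. [folklore] -/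
theorem roughCorr_eq_prod_filter (k d : ℕ) (z : ℝ) :
    roughCorr k d z = ∏ p ∈ (d.primeFactors.filter (fun p : ℕ => z ≤ (p : ℝ))).filter
      (fun p : ℕ => ¬ p ∣ k), (1 - (p : ℝ)⁻¹) := by
  rw [roughCorr, primeFactors_roughRadical]
  conv_rhs => rw [Finset.prod_filter]
  refine Finset.prod_congr rfl fun p hp => ?_
  rw [one_sub_coprimeRecip_prime k (Nat.prime_of_mem_primeFactors (Finset.mem_filter.1 hp).1)]
  by_cases h : p ∣ k <;> simp [h]

/-- `W_1(z) = ∏_{p<z} (1 − 1/p)`. [folklore] -/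
theorem roughDensity_one (z : ℝ) :
    roughDensity 1 z = ∏ p ∈ Nat.primesBelow ⌈z⌉₊, (1 - (p : ℝ)⁻¹) := by
  rw [roughDensity_eq_prod_filter, Finset.filter_true_of_mem]
  intro p hp
  exact Nat.Prime.not_dvd_one (Nat.prime_of_mem_primesBelow hp)

/-- `ρ_1(n, z) = ∏_{p ∣ n, p ≥ z} (1 − 1/p)`. [folklore] -/
theorem roughCorr_one (n : ℕ) (z : ℝ) :
    roughCorr 1 n z = ∏ p ∈ n.primeFactors.filter (fun p : ℕ => z ≤ (p : ℝ)), (1 - (p : ℝ)⁻¹) := by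
  rw [roughCorr_eq_prod_filter, Finset.filter_true_of_mem]
  intro p hp
  exact Nat.Prime.not_dvd_one (Nat.prime_of_mem_primeFactors (Finset.mem_filter.1 hp).1)

/-- **The main terms cancel**: for `k ≥ 1`, `d ≥ 1`,
`φ(k)⁻¹ W_1(z) ρ_1(dk, z) = k⁻¹ W_k(z) ρ_k(d, z)`, i.e. the expected number of rough `m ≡ r (k)`
coprime to `d` equals `φ(k)⁻¹` times the expected number of rough `m` coprime to `dk`. [folklore] -/
theorem main_term_identity {k d : ℕ} (hk : 0 < k) (hd : d ≠ 0) (z : ℝ) :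
    ((Nat.totient k : ℝ))⁻¹ * (roughDensity 1 z * roughCorr 1 (d * k) z) =
      ((k : ℝ))⁻¹ * (roughDensity k z * roughCorr k d z) := by
  set f : ℕ → ℝ := fun p => 1 - (p : ℝ)⁻¹ with hf
  have hk0 : k ≠ 0 := hk.ne'
  have hφ : (0 : ℝ) < Nat.totient k := by exact_mod_cast Nat.totient_pos.2 hk
  have hkR : (0 : ℝ) < k := by exact_mod_cast hk
  -- the four blocks
  set pB := Nat.primesBelow ⌈z⌉₊ with hpB
  set A := pB.filter (fun p : ℕ => ¬ p ∣ k) with hA          -- p < z, p ∤ k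
  set B := k.primeFactors.filter (fun p : ℕ => (p : ℝ) < z) with hB   -- p ∣ k, p < z
  set C := k.primeFactors.filter (fun p : ℕ => z ≤ (p : ℝ)) with hC   -- p ∣ k, p ≥ z
  set E := (d.primeFactors.filter (fun p : ℕ => z ≤ (p : ℝ))).filter (fun p : ℕ => ¬ p ∣ k) with hE
  -- `W_1 = ∏_A f * ∏_B f`
  have hW1 : roughDensity 1 z = (∏ p ∈ A, f p) * ∏ p ∈ B, f p := by
    rw [roughDensity_one, ← hpB, ← Finset.prod_filter_mul_prod_filter_not pB (fun p : ℕ => ¬ p ∣ k)]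
    congr 1
    refine Finset.prod_congr ?_ fun _ _ => rfl
    ext p
    simp only [hB, hpB, Finset.mem_filter, Nat.mem_primesBelow, not_not, Nat.mem_primeFactors, Nat.lt_ceil]
    constructor
    · rintro ⟨⟨hpz, hp⟩, hpk⟩; exact ⟨⟨hp, hpk, hk0⟩, hpz⟩
    · rintro ⟨⟨hp, hpk, -⟩, hpz⟩; exact ⟨⟨hpz, hp⟩, hpk⟩
  -- `W_k = ∏_A f`
  have hWk : roughDensity k z = ∏ p ∈ A, f p := roughDensity_eq_prod_filter k z
  -- `ρ_1(dk) = ∏_C f * ∏_E f`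
  have hρ1 : roughCorr 1 (d * k) z = (∏ p ∈ C, f p) * ∏ p ∈ E, f p := by
    rw [roughCorr_one, Nat.primeFactors_mul hd hk0]
    have hset : (d.primeFactors ∪ k.primeFactors).filter (fun p : ℕ => z ≤ (p : ℝ)) = C ∪ E := by
      ext p
      simp only [hC, hE, Finset.mem_filter, Finset.mem_union, Nat.mem_primeFactors]
      constructor
      · rintro ⟨h | h, hz⟩
        · by_cases hpk : p ∣ k
          · exact Or.inl ⟨⟨h.1, hpk, hk0⟩, hz⟩
          · exact Or.inr ⟨⟨h, hz⟩, hpk⟩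
        · exact Or.inl ⟨h, hz⟩
      · rintro (⟨h, hz⟩ | ⟨⟨h, hz⟩, -⟩)
        · exact ⟨Or.inr h, hz⟩
        · exact ⟨Or.inl h, hz⟩
    rw [hset, Finset.prod_union]
    rw [hC, hE, Finset.disjoint_left]
    rintro p hp hp'
    exact (Finset.mem_filter.1 hp').2 (Nat.mem_primeFactors.1 (Finset.mem_filter.1 hp).1).2.1
  -- `ρ_k(d) = ∏_E f`
  have hρk : roughCorr k d z = ∏ p ∈ E, f p := roughCorr_eq_prod_filter k d z
  -- `φ(k) = k ∏_B f ∏_C f`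
  have hφ' : (Nat.totient k : ℝ) = k * ((∏ p ∈ B, f p) * ∏ p ∈ C, f p) := by
    rw [LFunctions.MertensBound.totient_eq_mul_prod_one_sub_inv]
    simp only [one_div]
    rw [← Finset.prod_filter_mul_prod_filter_not k.primeFactors (fun p : ℕ => (p : ℝ) < z)]
    congr 2
    refine Finset.prod_congr ?_ fun _ _ => rfl
    ext p; simp [hC, not_lt]
  have hfpos : ∀ p : ℕ, p.Prime → 0 < f p := fun p hp =>
    sub_pos.2 (inv_lt_one_of_one_lt₀ (by exact_mod_cast hp.one_lt))
  have hBne : ∏ p ∈ B, f p ≠ 0 := Finset.prod_ne_zero_iff.2 fun p hp =>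
    (hfpos p (Nat.prime_of_mem_primeFactors (Finset.mem_filter.1 hp).1)).ne'
  have hCne : ∏ p ∈ C, f p ≠ 0 := Finset.prod_ne_zero_iff.2 fun p hp =>
    (hfpos p (Nat.prime_of_mem_primeFactors (Finset.mem_filter.1 hp).1)).ne'
  rw [hW1, hWk, hρ1, hρk, hφ']
  field_simp

/-! ### The discrepancy bound -/

/-- **The sieve discrepancy of a segment is small**: there is an absolute `C₀ > 0` such that
for `k ≥ 1`, reduced `r (mod k)`, `d ≥ 1`, `X₁ ≤ X₂` and `2 ≤ z ≤ D`,
`|#{X₁<m≤X₂ : m ≡ r (k), (m,d)=1, (m,P(z))=1} − φ(k)⁻¹ #{X₁<m≤X₂ : (m,dk)=1, (m,P(z))=1}|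
   ≤ 2 τ(d) τ(k)² (C₀ ((X₂−X₁)/k) e^{−log D/log z} + C₀ + D + 1)`
(the main terms cancel by `main_term_identity`; `1/φ(k) ≤ τ(k)/k`, `τ(dk) ≤ τ(d)τ(k)`).  This is the
Siegel–Walfisz-type input (A₂) for the sieved pieces `1_{(n,P(z))=1}` of BFI §15, and the estimate
for an almost-prime variable of §12 (p. 238). [cite: BombieriFriedlanderIwaniecActa1986, §12 p. 238 and §15 p. 246] -/
theorem roughCountCop_disc_le (hFL : SieveSequence.fundamental_lemma_uniform) :
    ∃ C₀ : ℝ, 0 < C₀ ∧ ∀ k : ℕ, 0 < k → ∀ r : ZMod k, IsUnit r → ∀ d : ℕ, d ≠ 0 →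
      ∀ X₁ X₂ : ℕ, X₁ ≤ X₂ → ∀ z D : ℝ, 2 ≤ z → z ≤ D →
        |(roughCountCop X₁ X₂ k r d z : ℝ) -
            (roughCountCop X₁ X₂ 1 0 (d * k) z : ℝ) / (Nat.totient k : ℝ)| ≤
          2 * (σ 0 d : ℝ) * (σ 0 k : ℝ) ^ 2 *
            (C₀ * (((X₂ : ℝ) - X₁) / k) * Real.exp (-(Real.log D / Real.log z)) + C₀ + D + 1) := by
  obtain ⟨C₀, hC₀, -, h⟩ := roughCountCop_approx hFL
  refine ⟨C₀, hC₀, fun k hk r hr d hd X₁ X₂ hX z D hz hzD => ?_⟩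
  have hk0 : k ≠ 0 := hk.ne'
  have hkR : (0 : ℝ) < k := by exact_mod_cast hk
  have hk1 : (1 : ℝ) ≤ k := by exact_mod_cast hk
  have hφ : (0 : ℝ) < Nat.totient k := by exact_mod_cast Nat.totient_pos.2 hk
  have hdk : d * k ≠ 0 := mul_ne_zero hd hk0
  set X : ℝ := ((X₂ : ℝ) - X₁) with hXd
  have hX0 : 0 ≤ X := sub_nonneg.2 (by exact_mod_cast hX)
  set ε := Real.exp (-(Real.log D / Real.log z)) with hε
  have hε0 : 0 ≤ ε := (Real.exp_pos _).le
  have hD0 : 0 ≤ D := by linarith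
  -- the two approximations
  have h1 := h k hk r hr d hd X₁ X₂ hX z D hz hzD
  have h2 := h 1 Nat.one_pos (0 : ZMod 1) (isUnit_of_subsingleton _) (d * k) hdk X₁ X₂ hX z D hz hzD
  simp only [Nat.cast_one, div_one] at h2
  -- main terms agree
  have hmain : X / k * roughDensity k z * roughCorr k d z =
      (X * roughDensity 1 z * roughCorr 1 (d * k) z) / (Nat.totient k : ℝ) := by
    have := main_term_identity hk hd z
    calc X / k * roughDensity k z * roughCorr k d z
        = X * (((k : ℝ))⁻¹ * (roughDensity k z * roughCorr k d z)) := by ring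
      _ = X * (((Nat.totient k : ℝ))⁻¹ * (roughDensity 1 z * roughCorr 1 (d * k) z)) := by rw [this]
      _ = (X * roughDensity 1 z * roughCorr 1 (d * k) z) / (Nat.totient k : ℝ) := by ring
  -- bounds for the constants
  have hτd : (1 : ℝ) ≤ σ 0 d := by exact_mod_cast one_le_sigma_zero hd
  have hτk : (1 : ℝ) ≤ σ 0 k := by exact_mod_cast one_le_sigma_zero hk0
  have hτdk : (σ 0 (d * k) : ℝ) ≤ (σ 0 d : ℝ) * σ 0 k := by exact_mod_cast sigma_zero_mul_le d k
  have hφinv : ((Nat.totient k : ℝ))⁻¹ ≤ (σ 0 k : ℝ) / k := inv_totient_le_sigma_zero_div k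
  have hφinv1 : ((Nat.totient k : ℝ))⁻¹ ≤ 1 := by
    rw [inv_le_one_iff₀]; right; exact_mod_cast Nat.totient_pos.2 hk
  have hW1 : roughDensity 1 z ≤ 1 := roughDensity_le_one 1 z
  have hWk : roughDensity k z ≤ 1 := roughDensity_le_one k z
  set E₀ : ℝ := C₀ + D + 1 with hE₀
  have hE₀0 : 0 ≤ E₀ := by positivity
  -- first error
  have e1 : |(roughCountCop X₁ X₂ k r d z : ℝ) - X / k * roughDensity k z * roughCorr k d z| ≤
      (σ 0 d : ℝ) * (C₀ * (X / k) * ε + E₀) := by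
    refine h1.trans (mul_le_mul_of_nonneg_left ?_ (by positivity))
    have : C₀ * (X / k) * roughDensity k z * ε ≤ C₀ * (X / k) * 1 * ε := by gcongr
    linarith
  -- second error
  have e2 : |(roughCountCop X₁ X₂ 1 0 (d * k) z : ℝ) / (Nat.totient k : ℝ) -
      (X * roughDensity 1 z * roughCorr 1 (d * k) z) / (Nat.totient k : ℝ)| ≤
      (σ 0 d : ℝ) * (σ 0 k : ℝ) ^ 2 * (C₀ * (X / k) * ε + E₀) := by
    rw [← sub_div, abs_div, abs_of_pos hφ, div_eq_mul_inv]
    calc |(roughCountCop X₁ X₂ 1 0 (d * k) z : ℝ) - X * roughDensity 1 z * roughCorr 1 (d * k) z| *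
          ((Nat.totient k : ℝ))⁻¹
        ≤ ((σ 0 (d * k) : ℝ) * (C₀ * X * roughDensity 1 z * ε + C₀ + D + 1)) * ((Nat.totient k : ℝ))⁻¹ :=
          mul_le_mul_of_nonneg_right h2 (by positivity)
      _ ≤ ((σ 0 d : ℝ) * σ 0 k * (C₀ * X * ε + E₀)) * ((Nat.totient k : ℝ))⁻¹ := by
          refine mul_le_mul_of_nonneg_right ?_ (by positivity)
          have hW0 := roughDensity_nonneg 1 z
          refine mul_le_mul hτdk ?_ (by positivity) (by positivity)
          have : C₀ * X * roughDensity 1 z * ε ≤ C₀ * X * 1 * ε := by gcongr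
          linarith
      _ = (σ 0 d : ℝ) * σ 0 k * (C₀ * X * ε * ((Nat.totient k : ℝ))⁻¹ + E₀ * ((Nat.totient k : ℝ))⁻¹) := by
          ring
      _ ≤ (σ 0 d : ℝ) * σ 0 k * (C₀ * X * ε * ((σ 0 k : ℝ) / k) + E₀ * 1) := by
          gcongr
      _ ≤ (σ 0 d : ℝ) * (σ 0 k : ℝ) ^ 2 * (C₀ * (X / k) * ε + E₀) := by
          have hA : 0 ≤ C₀ * X * ε := by positivity
          have h3 : (σ 0 d : ℝ) * σ 0 k * (E₀ * 1) ≤ (σ 0 d : ℝ) * (σ 0 k : ℝ) ^ 2 * E₀ := by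
            have h5 : (σ 0 d : ℝ) * σ 0 k * E₀ ≤ (σ 0 d : ℝ) * σ 0 k * E₀ * σ 0 k :=
              le_mul_of_one_le_right (by positivity) hτk
            calc (σ 0 d : ℝ) * σ 0 k * (E₀ * 1) = (σ 0 d : ℝ) * σ 0 k * E₀ := by ring
              _ ≤ (σ 0 d : ℝ) * σ 0 k * E₀ * σ 0 k := h5
              _ = (σ 0 d : ℝ) * (σ 0 k : ℝ) ^ 2 * E₀ := by ring
          have h4 : (σ 0 d : ℝ) * σ 0 k * (C₀ * X * ε * ((σ 0 k : ℝ) / k)) =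
              (σ 0 d : ℝ) * (σ 0 k : ℝ) ^ 2 * (C₀ * (X / k) * ε) := by
            field_simp
          nlinarith
  -- combine
  rw [hmain] at e1
  calc |(roughCountCop X₁ X₂ k r d z : ℝ) - (roughCountCop X₁ X₂ 1 0 (d * k) z : ℝ) / (Nat.totient k : ℝ)|
      = |((roughCountCop X₁ X₂ k r d z : ℝ) - (X * roughDensity 1 z * roughCorr 1 (d * k) z) / (Nat.totient k : ℝ)) -
          ((roughCountCop X₁ X₂ 1 0 (d * k) z : ℝ) / (Nat.totient k : ℝ) -
            (X * roughDensity 1 z * roughCorr 1 (d * k) z) / (Nat.totient k : ℝ))| := by ring_nf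
    _ ≤ |(roughCountCop X₁ X₂ k r d z : ℝ) - (X * roughDensity 1 z * roughCorr 1 (d * k) z) / (Nat.totient k : ℝ)| +
          |(roughCountCop X₁ X₂ 1 0 (d * k) z : ℝ) / (Nat.totient k : ℝ) -
            (X * roughDensity 1 z * roughCorr 1 (d * k) z) / (Nat.totient k : ℝ)| := abs_sub _ _
    _ ≤ (σ 0 d : ℝ) * (C₀ * (X / k) * ε + E₀) + (σ 0 d : ℝ) * (σ 0 k : ℝ) ^ 2 * (C₀ * (X / k) * ε + E₀) :=
        add_le_add e1 e2
    _ ≤ (σ 0 d : ℝ) * (σ 0 k : ℝ) ^ 2 * (C₀ * (X / k) * ε + E₀) +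
          (σ 0 d : ℝ) * (σ 0 k : ℝ) ^ 2 * (C₀ * (X / k) * ε + E₀) := by
        refine add_le_add ?_ le_rfl
        refine mul_le_mul_of_nonneg_right ?_ (by positivity)
        calc (σ 0 d : ℝ) = (σ 0 d : ℝ) * 1 := (mul_one _).symm
          _ ≤ (σ 0 d : ℝ) * (σ 0 k : ℝ) ^ 2 :=
              mul_le_mul_of_nonneg_left (one_le_pow₀ hτk) (by positivity)
    _ = 2 * (σ 0 d : ℝ) * (σ 0 k : ℝ) ^ 2 * (C₀ * (X / k) * ε + C₀ + D + 1) := by rw [hE₀]; ring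

end BFI

end Literature.NumberTheory.Sieve
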